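import Mathlib
import Summits.ValiantsHypothesis.ValiantsHypothesis.Theses.ValuativeGCT
import Summits.ValiantsHypothesis.ValiantsHypothesis.Theorems.ValuativeGCTNoValuativeFlipUnconditional

/-!
# `TailFlip` — negative lemmas II: no proof can use shapes of bounded length

Crux `stmt-ValiantsHypothesis-15687` (`Theses.ValuativeGCT.TailFlip`, route ValuativeGCT, rev 4).
`FlipAtLen n m L` is the crux body at `(n, m)` (verbatim) with the EXTRA witness constraint
`ℓ(λ) ≤ L`; `TailFlipLen L` is the crux with that body — the natural strengthening "flips in the tail
on shapes of bounded length".  It is FALSE for every `L` (`not_tailFlipLen`): slope `2/1`, window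
`c = L + 3`, `n = max n₀ (2^L + 3)`, padding `m = n^(L+2)` lies in the tail
(`pow_succ_le_two_pow_log_add_pow`) and beyond the inheritance range `1 + n(n+1)^L ≤ m`
(`one_add_mul_succ_pow_le_pow`), where bounded-length flips do not exist
(`not_flipAtLen_of_le` ← `noValuativeFlip_body_of_card_parts'`: support transfer + sized Valiant
universality + `ValuativeBound_proof`).  Moral for provers: along every window the witnesses' length
is unbounded, `ℓ(λ) > log_{n+1}((m-1)/n)`.  Standing disprover (cdisprove cycle 1, 2026-08-16),
`Cruxes/TailFlip/Disproof.lean` §3.  Sources: BLMW 2011 (arXiv:0907.2850) §5.3; Kadish–Landsberg 2014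
(arXiv:1204.4693); this route's `Theorems/ValuativeGCTNoValuativeFlipBoundedLength`. [folklore]
-/

-- `Summit.ValiantsHypothesis.ValiantsHypothesis.…` repeats a component by the D-0017 layout
-- (single-conjunct summit), which the `dupNamespace` linter flags; the name is mandated.
set_option linter.dupNamespace false

namespace Summit.ValiantsHypothesis.ValiantsHypothesis.Theorems.TailFlip.Negative

open Literature.NumberTheory.DiophantineGeometry Literature.Computability.AlgebraicComplexity
open Summit.ValiantsHypothesis.ValiantsHypothesis.Theses.ValuativeGCT
open Summit.ValiantsHypothesis.ValiantsHypothesis.Theorems.NoValuativeFlip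
open Summit.ValiantsHypothesis.ValiantsHypothesis.Theorems.ValuativeBound

/-- `FlipAtLen n m L`: the flip body with the EXTRA constraint `ℓ(λ) ≤ L` on the witness shape
(a natural strengthening: flips on shapes of bounded length). -/
def FlipAtLen (n m L : ℕ) [NeZero m] : Prop :=
  ∃ (U : Submodule ℂ (Literature.NumberTheory.DiophantineGeometry.MatIdx m → ℂ)) (r δ : ℕ) (lam : Nat.Partition (m * δ)), (∀ u ∈ U, (Matrix.of fun a b : Fin m => u (toLex (a, b))).rank ≤ r) ∧ lam.parts.card ≤ m * m ∧ lam.parts.card ≤ L ∧ (let χ : Literature.NumberTheory.DiophantineGeometry.Weight (Literature.NumberTheory.DiophantineGeometry.MatIdx m) := (Literature.NumberTheory.DiophantineGeometry.Weight.dualOfPartition (m * m) lam).toMatIdx; let T : Submodule ℂ (MvPolynomial (Literature.NumberTheory.DiophantineGeometry.MatIdx m × Literature.NumberTheory.DiophantineGeometry.MatIdx m) ℂ) := MvPolynomial.homogeneousSubmodule (Literature.NumberTheory.DiophantineGeometry.MatIdx m × Literature.NumberTheory.DiophantineGeometry.MatIdx m) ℂ (m * δ) ⊓ ((MvPolynomial.vanishingIdeal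 ℂ {p : Literature.NumberTheory.DiophantineGeometry.MatIdx m × Literature.NumberTheory.DiophantineGeometry.MatIdx m → ℂ | ∀ j : Literature.NumberTheory.DiophantineGeometry.MatIdx m, (fun i => p (j, i)) ∈ U}) ^ (δ * (m - r))).restrictScalars ℂ ⊓ (⨅ (M : Matrix (Literature.NumberTheory.DiophantineGeometry.MatIdx m) (Literature.NumberTheory.DiophantineGeometry.MatIdx m) ℂ) (_ : Literature.Computability.AlgebraicComplexity.linSubst (Literature.NumberTheory.DiophantineGeometry.MatIdx m) ℂ M (Literature.NumberTheory.DiophantineGeometry.detFormLex ℂ m) = Literature.NumberTheory.DiophantineGeometry.detFormLex ℂ m), LinearMap.ker ((MvPolynomial.aeval (R := ℂ) fun p : Literature.NumberTheory.DiophantineGeometry.MatIdx m × Literature.NumberTheory.DiophantineGeometry.MatIdx m => ∑ l : Literature.NumberTheory.DiophantineGeometry.MatIdx m, M l p.2 • MvPolynomial.X (p.1, l)).toLinearMap - LinearMap.id (R := ℂ) (M := MvPolynomial (Literature.NumberTheory.DiophantineGeometry.MatIdx m × Literature.NumberTheory.DiophantineGeometry.MatIdx m) ℂ))) ⊓ (⨅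 (g : Matrix.GeneralLinearGroup (Literature.NumberTheory.DiophantineGeometry.MatIdx m) ℂ) (_ : Literature.NumberTheory.DiophantineGeometry.IsUpperTriangular g), LinearMap.ker ((MvPolynomial.aeval (R := ℂ) fun p : Literature.NumberTheory.DiophantineGeometry.MatIdx m × Literature.NumberTheory.DiophantineGeometry.MatIdx m => ∑ l : Literature.NumberTheory.DiophantineGeometry.MatIdx m, ((g⁻¹ : Matrix.GeneralLinearGroup (Literature.NumberTheory.DiophantineGeometry.MatIdx m) ℂ) : Matrix (Literature.NumberTheory.DiophantineGeometry.MatIdx m) (Literature.NumberTheory.DiophantineGeometry.MatIdx m) ℂ) p.1 l • MvPolynomial.X (l, p.2)).toLinearMap - Literature.NumberTheory.DiophantineGeometry.weightChar χ g • LinearMap.id (R := ℂ) (M := MvPolynomial (Literature.NumberTheory.DiophantineGeometry.MatIdx m × Literature.NumberTheory.DiophantineGeometry.MatIdx m) ℂ))); Module.finrank ℂ ↥T < Literature.NumberTheory.DiophantineGeometry.orbitMultiplicity ℂ (Literature.NumberTheory.DiophantineGeometry.paddedPerFormLex ℂ n m) m χ)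

/-- **No bounded-length flip in the inheritance range** `m ≥ 1 + n (n+1)^L`: support transfer +
sized Valiant universality put `mult_pp(λ*) ≤ K_m(λ*)` for `ℓ(λ) ≤ L`
(`noValuativeFlip_body_of_card_parts'`). -/
theorem not_flipAtLen_of_le {n m L : ℕ} [NeZero m] (hm : 1 + n * (n + 1) ^ L ≤ m) :
    ¬ FlipAtLen n m L := by
  rintro ⟨U, r, δ, lam, hU, hcard, hlen, hlt⟩
  have hm' : 1 + n * (n + 1) ^ lam.parts.card ≤ m :=
    le_trans (Nat.add_le_add_left
      (Nat.mul_le_mul_left n (Nat.pow_le_pow_right (Nat.succ_pos n) hlen)) 1) hm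
  exact (not_le.mpr hlt) (noValuativeFlip_body_of_card_parts' m U r hU δ lam hcard hm')

/-! ## §3 Natural strengthenings refuted -/

/-- The crux with witnesses of BOUNDED LENGTH `ℓ(λ) ≤ L`. -/
def TailFlipLen (L : ℕ) : Prop :=
  ∀ a b : ℕ, b < a → ∀ c : ℕ, ∃ n₀ : ℕ, ∀ n ≥ n₀, ∀ (m : ℕ) [NeZero m],
    a * n < b * m → m ≤ 2 ^ ((Nat.log 2 n + c) ^ c) → FlipAtLen n m L

/-- **No proof can use shapes of bounded length**: `TailFlipLen L` is false for every `L`.  Slope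
`2/1`, window `c = L + 3`, `n = max n₀ (2^L + 3)`, padding `m = n^(L+2)` (in the tail:
`2n < n² ≤ m ≤ 2^((log₂ n + L + 3)^(L+3))`, `pow_succ_le_two_pow_log_add_pow`), where
`1 + n(n+1)^L ≤ m` (`one_add_mul_succ_pow_le_pow`) and `not_flipAtLen_of_le` applies.  Hence along
any window the witnesses' length is unbounded: `ℓ(λ) > log_{n+1}((m - 1)/n)`. -/
theorem not_tailFlipLen (L : ℕ) : ¬ TailFlipLen L := by
  intro h
  obtain ⟨n₀, hn₀⟩ := h 2 1 one_lt_two (L + 3)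
  set n : ℕ := max n₀ (2 ^ L + 3) with hn
  have hn0 : n₀ ≤ n := le_max_left _ _
  have hnL : 2 ^ L + 3 ≤ n := le_max_right _ _
  have hL1 : 1 ≤ 2 ^ L := Nat.one_le_two_pow
  have hn3 : 3 ≤ n := by omega
  haveI : NeZero (n ^ (L + 2)) := ⟨pow_ne_zero _ (by omega)⟩
  have hwin : n ^ (L + 2) ≤ 2 ^ ((Nat.log 2 n + (L + 3)) ^ (L + 3)) :=
    pow_succ_le_two_pow_log_add_pow n (L + 1)
  have hsq : n * n ≤ n ^ (L + 2) := by
    rw [← pow_two]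
    exact Nat.pow_le_pow_right (by omega) (by omega)
  have htail : 2 * n < 1 * n ^ (L + 2) := by nlinarith
  have hI : 1 + n * (n + 1) ^ L ≤ n ^ (L + 2) := one_add_mul_succ_pow_le_pow (by omega)
  exact not_flipAtLen_of_le hI (hn₀ n hn0 (n ^ (L + 2)) htail hwin)

end Summit.ValiantsHypothesis.ValiantsHypothesis.Theorems.TailFlip.Negative
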